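import Literature.AlgebraicGeometry.Resolution.AlterationsStrongAlgClosedLeaves12
import Literature.AlgebraicGeometry.Resolution.AlterationsLemma411VertexBlowupHolds
import Literature.AlgebraicGeometry.Resolution.VertexBlowupSectionPoint
import Literature.AlgebraicGeometry.Resolution.NormalizationSection
import Literature.AlgebraicGeometry.Resolution.AlterationsSmoothOverOpenHolds
import Literature.AlgebraicGeometry.Resolution.SmoothOverNormal
import Literature.AlgebraicGeometry.Motives.GoodReductionSpecialFibreProofs
import Mathlib.AlgebraicGeometry.AlgClosed.Basic
import HarnessLib

/-!
# De Jong 1996, 4.11–4.12 without `π₁(ℙ^{d-1}) = 0`: the exceptional divisor splits the Stein factorisation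

Topic: `Literature/AlgebraicGeometry/Resolution`. In 4.12 (pp. 68–69) de Jong argues: "Let
`X' → Y' → ℙ^{d-1}` be the Stein factorization of `f`. Note that `Y' → ℙ^{d-1}` is (finite)
étale, as all fibres of `f` contain a point where `f` is smooth […]. As `ℙ^{d-1}` is simply
connected [18], we conclude that `Y' = ℙ^{d-1}`, hence all fibres of `f` are geometrically
connected." The tree vendors the two inputs as the named facts `DeJong1996SteinFactorizationEtale`
and (via SGA 1 XI 1.1 = `ProjectiveLineSimplyConnected` + X 2.11 =
`EtaleCoverHyperplaneSectionConnected`) `ProjectiveSpaceSimplyConnected`. This file PROVES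
"`Y' = ℙ^{d-1}`" for the construction of 4.11 by an elementary route, making both inputs
unnecessary:

* the blown-up cover `X' = X ×_{ℙ^d} P̃` is SPLIT over the exceptional divisor `E ⊆ P̃` (over
  which `P̃ → ℙ^d` factors through the `k`-point at the vertex, `vertexChartSection_comp`, and
  `X` has a `k`-point over the vertex, `exists_point_over_vertexPt` — `π` is surjective and `k`
  is algebraically closed), and `E` is a section of `q : P̃ → ℙ^{d-1}` over the standard charts
  (`vertexChartSection_comp_projection`); so `f = q ∘ pr₂ : X' → ℙ^{d-1}` has a LOCAL SECTION
  over the chart `D₊(y₀)` (`exists_section_construction`);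
* a quasi-compact quasi-separated morphism from an integral scheme to a normal integral scheme
  with a local section has `Y' = f.normalization → ℙ^{d-1}` an isomorphism
  (`isIso_fromNormalization_of_section`, `NormalizationSection.lean`; `ℙ^{d-1}` is normal,
  `isIntegrallyClosed_stalk_projSpace`), so by Zariski's connectedness theorem in its Stein form
  (the named fact `steinFactorization_geometricallyConnected`, Stacks 03H2 (1)) all fibres of `f`
  are geometrically connected (`geometricallyConnected_construction`);
* hence **`DeJong1996FibrationReduction` (4.11 with 4.12) from TWO named facts**
  (`DeJong1996Lemma411VertexChoice` — the generic choice of `π`, `p`, Bertini — and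
  `steinFactorization_geometricallyConnected`): `DeJong1996FibrationReduction.of_vertexChoice_of_stein`,
  everything else on the way being proved in the tree (the blow-up of `ℙ^d` in the vertex and its
  projection, `DeJong1996VertexBlowupProjection_holds`; the three construction steps; 2.8,
  `DeJong1996SmoothOverOpen_holds`; projectivity of blow-ups);
* and the count of open leaves below de Jong's Theorem 4.1 over algebraically closed fields drops
  to NINE (`DeJong1996StrongAlgClosed.of_openLeaves₉`): `DeJong1996Lemma411VertexChoice`,
  `steinFactorization_geometricallyConnected`, `DeJong1996MultisectionHyperplane`,
  `DeJong1996GaloisNormalization`, `DeJong1996StableExtension`, `DeJong1996RationalMapExtension`,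
  `DeJong1996NodeLocalStructure`, `DeJong1996NodeLocalStructureCodimTwo`,
  `DeJong1996SemiStableCodimTwoBlowupCore` — `DeJong1996SteinFactorizationEtale` and
  `EtaleCoverHyperplaneSectionConnected` are no longer needed.

No named facts.

## Sources

* A. J. de Jong, *Smoothness, semi-stability and alterations*, Publ. Math. IHÉS 83 (1996) 51–93:
  Lemma 4.11 and 4.12, pp. 67–69. [DeJong1996]
* The Stacks Project, Tags 03H2, 035H, 0AY8. [StacksProject]
-/

noncomputable section

open CategoryTheory CategoryTheory.Limits AlgebraicGeometry TopologicalSpace Topology HomogeneousLocalization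

attribute [local instance] MvPolynomial.gradedAlgebra
  Literature.AlgebraicGeometry.Motives.ProjBaseChange.algebraBase
  Literature.AlgebraicGeometry.Motives.ProjBaseChange.isScalarTower_localization

namespace Literature.AlgebraicGeometry.Resolution

universe u

open Literature.AlgebraicGeometry.Motives (projectiveSpace IsProjectiveOver projectiveSpace_hom_eq_toSpec)
open Literature.AlgebraicGeometry.Motives.Segre (grading chartι toSpec)
open Literature.AlgebraicGeometry.Morphisms Literature.AlgebraicGeometry.FundamentalGroup

/-! ## `ℙ^d` is normal -/

/-- The local rings of `ℙ^d_K` are integrally closed (`ℙ^d_K` is smooth over `K`, and smooth over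
a normal base is normal, `isIntegrallyClosed_stalk_of_mem_smoothLocus`). [folklore] -/
theorem isIntegrallyClosed_stalk_projSpace (d : ℕ) (K : Type u) [Field K] (y : Motives.ProjSpace.P d K) :
    IsIntegrallyClosed ((Motives.ProjSpace.P d K).presheaf.stalk y) := by
  haveI : SmoothOfRelativeDimension d (Motives.ProjSpace.P d K ↘ Spec (.of K)) :=
    Motives.ProjectiveSpace.smoothOfRelativeDimension_projToSpec d K
  haveI : Smooth (Motives.ProjSpace.P d K ↘ Spec (.of K)) := SmoothOfRelativeDimension.smooth d _
  haveI : Surjective (Motives.ProjSpace.P d K ↘ Spec (.of K)) :=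
    ⟨fun s ↦ ⟨Motives.ProjSpace.zeroPt, Subsingleton.elim _ _⟩⟩
  have hS : ∀ s : Spec (.of K), IsIntegrallyClosed ((Spec (.of K)).presheaf.stalk s) :=
    Motives.isIntegrallyClosed_stalk_Spec (.of K)
  have hy : y ∈ (Motives.ProjSpace.P d K ↘ Spec (.of K)).smoothLocus := by
    rw [Scheme.Hom.smoothLocus_eq_top]
    trivial
  exact isIntegrallyClosed_stalk_of_mem_smoothLocus _ hS hy

/-! ## The local section of `f = q ∘ pr₂ : X ×_{ℙ^{d+1}} P̃ → ℙ^d` -/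

namespace DeJong1996

variable {k : Type u} [Field k] [IsAlgClosed k] {X : Scheme.{u}} {fX : X ⟶ Spec (.of k)} {Z : Set X}
  {d : ℕ} {π : X ⟶ (projectiveSpace (d + 1) k).left}

/-- **`X` has a `k`-point over the vertex**: `π` is surjective and `k` is algebraically closed, so
the (finite, non-empty) fibre `X ×_{ℙ^{d+1}} Spec k` of `π` over the `k`-point at the vertex has a
`k`-rational point (Hilbert's Nullstellensatz, Mathlib `pointOfClosedPoint`).
[cite: DeJong1996, 4.12, p. 68] -/
theorem exists_point_over_vertexPt (hπ : Lemma411Projection fX Z d π (vertex d k))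
    {P : Scheme.{u}} {b : P ⟶ Proj (grading (Fin (d + 1 + 1)) k)} (hb : IsBlowup b (vertexIdealSheaf d k)) :
    ∃ x₀ : Spec (.of k) ⟶ X, x₀ ≫ π = vertexPt d k := by
  haveI := hπ.isFinite
  haveI := hπ.surjective
  -- the fibre of `π` over the `k`-point at the vertex
  let F := pullback π (vertexPt d k)
  let pt : Spec (.of k) := IsLocalRing.closedPoint k
  obtain ⟨x, hx⟩ := π.surjective (vertex d k)
  have hx' : π x = vertexPt d k pt := by rw [hx, vertexPt_apply hb]
  obtain ⟨z, -, -⟩ := Scheme.Pullback.exists_preimage_pullback (f := π) (g := vertexPt d k) x pt hx'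
  haveI : IsAffine F := isAffine_of_isAffineHom (pullback.snd π (vertexPt d k))
  obtain ⟨z₀, -, hz₀⟩ := (isClosed_univ (X := F)).exists_closed_singleton ⟨z, Set.mem_univ z⟩
  refine ⟨pointOfClosedPoint (pullback.snd π (vertexPt d k)) z₀ hz₀ ≫ pullback.fst π (vertexPt d k), ?_⟩
  rw [Category.assoc, pullback.condition, ← Category.assoc, pointOfClosedPoint_comp, Category.id_comp]

/-- **The local section of `f = q ∘ pr₂` over the chart `D₊(y₀)`** of `ℙ^d`: lift the chart
section `s₀ : D₊(y₀) → P̃` of `q` through `E` to `X' = X ×_{ℙ^{d+1}} P̃`, using that `s₀ ≫ b`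
factors through the `k`-point at the vertex and a `k`-point of `X` over it.
[cite: DeJong1996, 4.12, pp. 68–69] -/
theorem exists_section_construction (hπ : Lemma411Projection fX Z d π (vertex d k))
    {P : Scheme.{u}} {b : P ⟶ Proj (grading (Fin (d + 1 + 1)) k)} [IsIntegral P] [IsDominant b]
    (hb : IsBlowup b (vertexIdealSheaf d k)) :
    ∃ σ : ((chartι k (0 : Fin (d + 1))).opensRange : Scheme.{u}) ⟶ pullback π b,
      σ ≫ (pullback.snd π b ≫ vertexBlowupProjection b hb) = (chartι k (0 : Fin (d + 1))).opensRange.ι := by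
  obtain ⟨x₀, hx₀⟩ := exists_point_over_vertexPt hπ hb
  let σ' : Spec (.of (Away (grading (Fin (d + 1)) k) (MvPolynomial.X (0 : Fin (d + 1))))) ⟶ pullback π b :=
    pullback.lift (Spec.map (CommRingCat.ofHom (algebraMap k _)) ≫ x₀) (vertexChartSection hb 0) (by
      rw [Category.assoc, hx₀]
      exact (vertexChartSection_comp hb 0).symm)
  refine ⟨(chartι k (0 : Fin (d + 1))).isoOpensRange.inv ≫ σ', ?_⟩
  rw [Category.assoc, pullback.lift_snd_assoc, vertexChartSection_comp_projection,
    Scheme.Hom.isoOpensRange_inv_comp]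

/-- **All fibres of `f = q ∘ pr₂` are geometrically connected** ("`Y' = ℙ^{d-1}`" in 4.12,
WITHOUT the étaleness of `Y' → ℙ^{d-1}` and the simple connectedness of `ℙ^{d-1}`): `f` has a
local section, so `f.fromNormalization` is an isomorphism (`isIso_fromNormalization_of_section`),
and Zariski's connectedness theorem (`steinFactorization_geometricallyConnected`) applies.
[cite: DeJong1996, 4.12, pp. 68–69] -/
theorem geometricallyConnected_construction (hS : steinFactorization_geometricallyConnected.{u})
    (hπ : Lemma411Projection fX Z d π (vertex d k))
    {P : Scheme.{u}} {b : P ⟶ Proj (grading (Fin (d + 1 + 1)) k)} [IsIntegral P] [IsDominant b]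
    (hb : IsBlowup b (vertexIdealSheaf d k)) [IsIntegral (pullback π b)]
    [IsProper (pullback.snd π b ≫ vertexBlowupProjection b hb)] :
    GeometricallyConnected (pullback.snd π b ≫ vertexBlowupProjection b hb) := by
  obtain ⟨σ, hσ⟩ := exists_section_construction hπ hb
  haveI : Nonempty (chartι k (0 : Fin (d + 1))).opensRange :=
    ⟨⟨chartι k 0 (PrimeSpectrum.comap (PointBlowup.awayBaseEquiv d k 0).toRingHom ⟨⊥, Ideal.isPrime_bot⟩),
      _, rfl⟩⟩
  haveI : IsIntegral (Proj (grading (Fin (d + 1)) k)) := Motives.ProjSpace.isIntegral d k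
  haveI : IsIso (pullback.snd π b ≫ vertexBlowupProjection b hb).fromNormalization :=
    isIso_fromNormalization_of_section _ (isIntegrallyClosed_stalk_projSpace d k)
      (isAffineOpen_opensRange _) σ hσ
  exact hS.of_isIso_fromNormalization _

end DeJong1996

/-! ## 4.11–4.12 from `DeJong1996Lemma411VertexChoice` and Stein -/

/-- **`DeJong1996FibrationReduction` (Lemma 4.11 with 4.12) from the generic choice of `π`, `p`
(`DeJong1996Lemma411VertexChoice`) and Zariski's connectedness theorem in its Stein form
(`steinFactorization_geometricallyConnected`)** — the proof of
`DeJong1996FibrationReduction.of_lemma411` run with the blow-up of the vertex constructed in the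
tree (`DeJong1996VertexBlowupProjection_holds`) and the geometric connectedness of the fibres of
`f` obtained from the local section (`geometricallyConnected_construction`).
[cite: DeJong1996, Lemma 4.11 and 4.12, pp. 67–69] -/
theorem DeJong1996FibrationReduction.of_vertexChoice_of_stein
    (hC : DeJong1996Lemma411VertexChoice.{u}) (hS : steinFactorization_geometricallyConnected.{u}) :
    DeJong1996FibrationReduction.{u} := by
  intro k _ _ X fX Z hP h1
  haveI := hP.isIntegral
  haveI := hP.isProper
  haveI : IsLocallyNoetherian X := LocallyOfFiniteType.isLocallyNoetherian fX
  haveI : CompactSpace X := QuasiCompact.compactSpace_of_compactSpace fX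
  obtain ⟨d, hd⟩ := exists_nat_topologicalKrullDim_eq_succ fX h1
  -- Lemma 4.11 via the construction, with the blow-up of the vertex built in the tree
  obtain ⟨π, hπ, hcd⟩ := hC k X fX Z d inferInstance hP.isProjectiveOver hP.exists_isEffectiveCartier hd
  obtain ⟨P, b, hb⟩ := exists_isBlowup (Proj (grading (Fin (d + 1 + 1)) k)) (DeJong1996.vertexIdealSheaf d k)
  haveI := DeJong1996.isIntegral_of_isBlowup_vertex hb
  haveI := DeJong1996.isDominant_of_isBlowup_vertex hb
  have hM := DeJong1996.pointBlowupProjection_vertexBlowupProjection b hb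
  obtain ⟨hc, hdd⟩ := hcd P b (DeJong1996.vertexBlowupProjection b hb) hM
    (DeJong1996.isVertexProjection_vertexBlowupProjection b hb)
  have hF : DeJong1996.IsLemma411Fibration fX Z d (pullback.fst π b)
      (pullback.snd π b ≫ DeJong1996.vertexBlowupProjection b hb) :=
    DeJong1996.isLemma411Fibration_of_blowup_of_fibreDimension_of_smoothLocusDense
      DeJong1996Lemma411Blowup_holds DeJong1996Lemma411FibreDimension_holds
      DeJong1996Lemma411SmoothLocusDense_holds hP.isProjectiveOver hd hπ hM hc
  have hy := hdd hP.isIntegrallyClosed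
  set X' := pullback π b
  set φ := pullback.fst π b
  set f := pullback.snd π b ≫ DeJong1996.vertexBlowupProjection b hb
  obtain ⟨S, hS', hSf, hSc, hSreg, -, hblow⟩ := hF.exists_isBlowup
  have hJ := vanishingIdeal_ne_bot_of_forall_isClosed h1 hS' hSc
  have hφ : IsAlteration φ := isAlteration_of_isBlowup hblow hJ
  haveI := hφ.isIntegral
  haveI := hφ.isProper
  haveI := hφ.isDominant
  -- 4.12: `f` is smooth over a non-empty open (2.8), and its fibres are geometrically connected
  obtain ⟨V, hVne, hVsm⟩ := DeJong1996SmoothOverOpen_holds k X fX Z d X' φ f hP hd hF hy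
  have hconn : GeometricallyConnected f := by
    haveI : IsProper f := hF.isProper hP hd
    exact DeJong1996.geometricallyConnected_construction hS hπ hb
  haveI := isIntegral_projectiveSpace (n := d) (k := k)
  have hη : genericPoint (projectiveSpace d k).left ∈ V :=
    ((genericPoint_spec (projectiveSpace d k).left).mem_open_set_iff V.isOpen).mpr
      (by simpa using hVne)
  haveI : Smooth (f ∣_ V) := hVsm
  refine ⟨X', φ, hφ, isGenericallyEtale_of_isBlowup hblow, ?_, ?_⟩
  · -- (iii), (iv), (v) for `(X', φ⁻¹ Z)`: blow-ups are projective, 4.10, "`X'` is normal also"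
    obtain ⟨D, hD, hDZ⟩ := hP.exists_isEffectiveCartier
    exact
      { isIntegral := inferInstance
        isProjectiveOver := BlowupProjectiveOverField_holds k X X' fX _ φ inferInstance
          hP.isProjectiveOver hJ hblow
        exists_isEffectiveCartier := ⟨D.comap φ, hD.comap_of_isDominant φ, by
          rw [Scheme.IdealSheafData.support_comap, TopologicalSpace.Closeds.coe_preimage, hDZ]⟩
        isIntegrallyClosed := fun x' => hblow.isIntegrallyClosed_stalk_of_finite
          (isOpen_regularLocus_of_locallyOfFiniteType_perfectField fX) hP.isIntegrallyClosed hS'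
          hSf hSc hSreg x' }
  · -- (vi) a)–d) for `f : X' → ℙ^d`
    exact ⟨(projectiveSpace d k).left, inferInstance, (projectiveSpace d k).hom, f,
      isProjectiveOver_projectiveSpace d k, hF.comp_hom,
      { locallyOfFinitePresentation := hF.locallyOfFinitePresentation
        surjective := hF.surjective
        geometricallyConnected := hconn
        topologicalKrullDim_eq_one := hF.topologicalKrullDim_eq_one
        dense_preimage_smoothLocus := hF.dense_preimage_smoothLocus
        smooth_fiberToSpecResidueField_genericPoint :=
          smooth_fiberToSpecResidueField_of_mem f V hη },
      hF.isFiniteGenericallyEtaleOn⟩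

/-! ## Thm. 4.1 over algebraically closed fields from NINE open leaves -/

/-- **4.11–4.28 (`DeJong1996NormalProjectiveStep`) from nine open leaves.**
[cite: DeJong1996, 4.11–4.28, pp. 67–76] -/
theorem DeJong1996NormalProjectiveStep.of_openLeaves₉
    -- 4.11–4.12
    (hC : DeJong1996Lemma411VertexChoice.{u}) (hZ : steinFactorization_geometricallyConnected.{u})
    -- 4.13–4.22
    (h13 : DeJong1996MultisectionHyperplane.{u}) (h16 : DeJong1996GaloisNormalization.{u})
    (h17 : DeJong1996StableExtension.{u}) (h18 : DeJong1996RationalMapExtension.{u})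
    -- 4.23–4.28
    (hN : DeJong1996NodeLocalStructure.{u}) (hN₂ : DeJong1996NodeLocalStructureCodimTwo.{u})
    (hK : DeJong1996SemiStableCodimTwoBlowupCore.{u}) :
    DeJong1996NormalProjectiveStep.{u} :=
  DeJong1996NormalProjectiveStep.of_threeBlocks
    (DeJong1996FibrationReduction.of_vertexChoice_of_stein hC hZ)
    (DeJong1996FibrationToSemiStablePair.of_printedLeaves h13 h16 h17 h18)
    (DeJong1996SemiStablePairResolution.of_openLeaves hN hN₂ hK DeJong1996NodalBlowupSingularLocus_holds)

/-- **Thm. 4.1 with its generically-étale clause over algebraically closed fields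
(`DeJong1996StrongAlgClosed`) from nine open leaves.** [cite: DeJong1996, Thm. 4.1 and 4.3–4.28, pp. 66–76] -/
theorem DeJong1996StrongAlgClosed.of_openLeaves₉
    (hC : DeJong1996Lemma411VertexChoice.{u}) (hZ : steinFactorization_geometricallyConnected.{u})
    (h13 : DeJong1996MultisectionHyperplane.{u}) (h16 : DeJong1996GaloisNormalization.{u})
    (h17 : DeJong1996StableExtension.{u}) (h18 : DeJong1996RationalMapExtension.{u})
    (hN : DeJong1996NodeLocalStructure.{u}) (hN₂ : DeJong1996NodeLocalStructureCodimTwo.{u})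
    (hK : DeJong1996SemiStableCodimTwoBlowupCore.{u}) :
    DeJong1996StrongAlgClosed.{u} :=
  DeJong1996StrongAlgClosed.of_step
    (DeJong1996NormalProjectiveStep.of_openLeaves₉ hC hZ h13 h16 h17 h18 hN hN₂ hK)

/-- … and Thm. 4.1 (i)+(ii) over every field, its last sentence over perfect fields, (i) alone
and the weak form, from the same nine leaves. [cite: DeJong1996, Thm. 4.1, p. 66] -/
theorem DeJong1996Strong.of_openLeaves₉
    (hC : DeJong1996Lemma411VertexChoice.{u}) (hZ : steinFactorization_geometricallyConnected.{u})
    (h13 : DeJong1996MultisectionHyperplane.{u}) (h16 : DeJong1996GaloisNormalization.{u})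
    (h17 : DeJong1996StableExtension.{u}) (h18 : DeJong1996RationalMapExtension.{u})
    (hN : DeJong1996NodeLocalStructure.{u}) (hN₂ : DeJong1996NodeLocalStructureCodimTwo.{u})
    (hK : DeJong1996SemiStableCodimTwoBlowupCore.{u}) :
    DeJong1996Strong.{u} ∧ DeJong1996StrongPerfect.{u} ∧ DeJong1996Projective.{u} ∧ DeJong1996.{u} :=
  have h := DeJong1996Descent_holds
    (DeJong1996StrongAlgClosed.of_openLeaves₉ hC hZ h13 h16 h17 h18 hN hN₂ hK)
  ⟨h.1, h.2, h.1.projective, h.1.deJong1996⟩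

end Literature.AlgebraicGeometry.Resolution

end
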